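import Summits.QuantumFields.YangMills.Theorems.BalabanLadderNTWeakPackage

/-!
# Re-cut candidate v3 «weak-package» for crux `NT` (stmt-QuantumFields-19353) — STAGED, NOT REGISTERED

Fleet lead `ym-spine-19353-p1` (g2), 2026-08-26.  The skeleton of record v2 «conditional-package»
(`Cruxes/NT/Lines/birth.lean`, b5b471720c374849) has ONE stub `stub_cfp : CFP` (`∃ (r, a)`, units ∧ `FBL ∧ FC2 ∧ FC3`)
and closes the crux through the landed `stub_lower`.  The clause-level CONSUMPTION AUDIT of that composition (landed
`Theorems/BalabanLadderNTWeakPackage{TwoPoint,ThreePoint,ThreePointMain,}.lean`, p454125 p454433 p454910 p455082)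
shows `stub_lower` consumes of `FC2`/`FC3` only: (F) a two-point FLOOR on x-centred femto cubes in the forward cone with
growth `Γ(s)/s⁸ → ∞` (no continuity, no upper bound, no `Γ ≤ 1`); (A) a SIGN-FREE clustering bound
`|ν⁸ kerCov| ≤ C₂` on x-centred cubes; (T) `FC3` on x-centred cubes without `1 ≤ n₃` / continuity / positivity of
`Γ₃`.  This candidate replaces `CFP` by exactly that package; `NT_of := WeakPackage.nt_of_weakPackage stub_cfpw`
concludes `BalabanLadder.NT` BY NAME (kernel-checked).  `CFP → CFPW` conjunct-wise (`WeakPackage.floor_of_fc2`,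
`abs_of_fc2`, `fc3Weak_of_fc3`), so v3 asks STRICTLY LESS of the engine than v2.

consumes: `stub_cfpw` has no hypothesis binder (pure existence statement).  Owner's call whether to register
(one reshape per generation); until then v2 stands and these files are helpers under it.
-/

set_option autoImplicit false

noncomputable section

open Filter Topology
open Literature.MathematicalPhysics.QuantumFieldTheory Literature.MathematicalPhysics.QuantumLattice
open Literature.Probability.LatticeModels
open Summit.QuantumFields.YangMills.Cruxes.OSLegsFromFemtoAndGap.DlrCollarTransfer

namespace Summit.QuantumFields.YangMills.Cruxes.NT.BirthV3

/-- **CFPW — the WEAK conditional femto package, existence form.**  For every compact simple `G` (Borel σ-algebra)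
there are a lattice representation `r` and a unit map `a` (`0 < a`, `a → 0`) carrying: the femto boundary law
`FBL G r a`; (F) the conditional two-point floor on x-centred femto cubes `[x−R, x+R]⁴` for pairs `(x, y)` in the
forward cone `‖y−x‖ < 3 (y−x)₀`, with a shape `Γ` growing faster than `s⁸` at `0⁺` and a scale-indexed collar `K`
(`s K(s) → 0`); (A) the sign-free clustering bound `|‖u'−u‖⁸ · kerCov (dens u) (dens u')| ≤ C₂` for deep pairs of
x-centred femto cubes; (T) the signed conditional third-cumulant floor at one reference triangle shape based at the
centre.  XL / unprinted (engine), but strictly weaker than v2's `CFP`. -/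
def CFPW : Prop :=
  ∀ (G : Type) [Group G] [TopologicalSpace G] [IsTopologicalGroup G] [CompactSpace G],
    IsCompactSimpleLieGroup G → letI : MeasurableSpace G := borel G; haveI : BorelSpace G := ⟨rfl⟩;
    ∃ (r : LatticeRep G) (a : ℝ → ℝ), (∀ β, 0 < a β) ∧ Tendsto a atTop (𝓝 0) ∧ FBL G r a ∧
    (∃ (Γ : ℝ → ℝ) (β₂ ℓ₂ c₂ : ℝ) (K : ℝ → ℝ) (n₀ : ℕ), 0 < ℓ₂ ∧ 0 < c₂ ∧ (∀ s, 1 ≤ K s) ∧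
      Tendsto (fun s : ℝ => s * K s) (nhdsWithin 0 (Set.Ioi 0)) (nhds 0) ∧ 1 ≤ n₀ ∧
      Tendsto (fun s : ℝ => Γ s / s ^ 8) (nhdsWithin 0 (Set.Ioi 0)) atTop ∧
      ∀ β : ℝ, β₂ ≤ β → ∀ (x : Fin 4 → ℤ) (R : ℕ), ((2 * R + 1 : ℕ) : ℝ) * a β ≤ ℓ₂ →
        ∀ (η : LGConfig 4 G) (y : Fin 4 → ℤ) (s₀ : ℝ), 0 < s₀ → s₀ ≤ ‖siteToE (y - x)‖ * a β →
          (n₀ : ℝ) ≤ ‖siteToE (y - x)‖ → ‖siteToE (y - x)‖ < 3 * siteToE (y - x) 0 →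
            K s₀ * ‖siteToE (y - x)‖ ≤ depth (fun j => x j - R) (2 * R + 1) y →
              c₂ * Γ (‖siteToE (y - x)‖ * a β) ≤
                ‖siteToE (y - x)‖ ^ 8 *
                  kerCov G r β (fun j => x j - R) (2 * R + 1) η (dens G r x) (dens G r y)) ∧
    (∃ (β₂ ℓ₂ C₂ : ℝ) (K : ℝ → ℝ) (n₀ : ℕ), 0 < ℓ₂ ∧ (∀ s, 1 ≤ K s) ∧
      Tendsto (fun s : ℝ => s * K s) (nhdsWithin 0 (Set.Ioi 0)) (nhds 0) ∧ 1 ≤ n₀ ∧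
      ∀ β : ℝ, β₂ ≤ β → ∀ (x : Fin 4 → ℤ) (R : ℕ), ((2 * R + 1 : ℕ) : ℝ) * a β ≤ ℓ₂ →
        ∀ (η : LGConfig 4 G) (u u' : Fin 4 → ℤ) (s₀ : ℝ), 0 < s₀ → s₀ ≤ ‖siteToE (u' - u)‖ * a β →
          ‖siteToE (u' - u)‖ * a β ≤ ℓ₂ → (n₀ : ℝ) ≤ ‖siteToE (u' - u)‖ →
            K s₀ * ‖siteToE (u' - u)‖ ≤ depth (fun j => x j - R) (2 * R + 1) u →
            K s₀ * ‖siteToE (u' - u)‖ ≤ depth (fun j => x j - R) (2 * R + 1) u' →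
              |‖siteToE (u' - u)‖ ^ 8 *
                  kerCov G r β (fun j => x j - R) (2 * R + 1) η (dens G r u) (dens G r u')| ≤ C₂) ∧
    (∃ (v w : EuclideanSpace ℝ (Fin 4)) (σ δ : ℝ) (Γ₃ : ℝ → ℝ) (β₃ ℓ₃ c₃ : ℝ) (K₃ : ℝ → ℝ) (n₃ : ℕ),
      (σ = 1 ∨ σ = -1) ∧ 0 < δ ∧ 2 * δ < ‖v‖ ∧ 2 * δ < ‖w‖ ∧ 2 * δ < ‖v - w‖ ∧ 0 < ℓ₃ ∧ 0 < c₃ ∧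
      (∀ s, 1 ≤ K₃ s) ∧ Tendsto (fun s : ℝ => s * K₃ s) (nhdsWithin 0 (Set.Ioi 0)) (nhds 0) ∧
      Tendsto (fun s : ℝ => Γ₃ s / s ^ 4) (nhdsWithin 0 (Set.Ioi 0)) atTop ∧
      ∀ β : ℝ, β₃ ≤ β → ∀ (x : Fin 4 → ℤ) (R : ℕ), ((2 * R + 1 : ℕ) : ℝ) * a β ≤ ℓ₃ →
        ∀ (η : LGConfig 4 G) (n : ℕ) (y z : Fin 4 → ℤ) (s₀ : ℝ), 0 < s₀ → s₀ ≤ (n : ℝ) * a β →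
          n₃ ≤ n → ‖siteToE (y - x) - (n : ℝ) • v‖ ≤ δ * n → ‖siteToE (z - x) - (n : ℝ) • w‖ ≤ δ * n →
            K₃ s₀ * n ≤ depth (fun j => x j - R) (2 * R + 1) x →
            K₃ s₀ * n ≤ depth (fun j => x j - R) (2 * R + 1) y →
            K₃ s₀ * n ≤ depth (fun j => x j - R) (2 * R + 1) z →
              c₃ * Γ₃ ((n : ℝ) * a β) ≤
                σ * (n : ℝ) ^ 12 * kerK3 G r β (fun j => x j - R) (2 * R + 1) η x y z)

/-- stub (engine, XL): the weak conditional femto package exists for one `(r, a)` per compact simple `G`. -/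
theorem stub_cfpw : CFPW := by
  sorry

/-- **Composition (real proof): the single stub gives the crux `BalabanLadder.NT` BY NAME** (landed
`WeakPackage.nt_of_weakPackage`: `lowerBounds_twoPoint_weak` + `lowerBounds_threePoint_weak`). -/
theorem NT_of : Summit.QuantumFields.YangMills.Theses.BalabanLadder.NT :=
  WeakPackage.nt_of_weakPackage stub_cfpw

end Summit.QuantumFields.YangMills.Cruxes.NT.BirthV3

end
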